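import Literature.Probability.LatticeModels.InterfaceSLEAssembly
import Literature.Probability.RandomPlanarGeometry.SLELawOfDrivingProcessLocal
import HarnessLib

/-!
# Critical Ising interfaces and SLE₃: from the two CDHKS driving martingales to the SLE₃ law

Topic `Literature/Probability/LatticeModels` (family `crit-ising`). Sixth file of the
decomposition of **crit-ising.S17, spin half** — Chelkak–Duminil-Copin–Hongler–Kemppainen–Smirnov,
*Convergence of Ising interfaces to Schramm's SLE curves*, C. R. Math. Acad. Sci. Paris 352 (2014)
157–161 (arXiv:1312.0533), Theorem 1, corrected transcription
`convergesInLawToSLE_three_isingInterface_zd` (`InterfaceSLEProofs.lean`) — after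
`InterfaceSLEProofs.lean` (F1 ∧ F2 ∧ uniqueness ⟹ S17-zd), `InterfaceSLETightness.lean`
((C1) ⟹ F1), `InterfaceSLEIdentification.lean` (uniqueness discharged; the two CDHKS
martingales in Lévy's format) and `InterfaceSLEAssembly.lean` (selection rules exist; the
Rohde–Schramm inputs at `κ = 3` are necessary).

**The last paragraph of CDHKS's proof of Theorem 1, as a theorem of the tree.** CDHKS §3 ends:
"both coefficients `W_t` and `W_t² - 3t` are martingales. As `W_t` is almost surely continuous,
Lévy's theorem implies that `W_t = √3 B_t`, where `B_t` is a standard Brownian motion, for any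
subsequential limit of the curves `γ^δ`." Here this passage is PROVED, for one limit law and
unconditionally:

* `isSLELaw_three_of_drivingMartingales` (**local form**): if a probability measure `ν` on the
  curve space carries a process `W : CurveClass ℂ → ([0, ∞) → ℝ)` and a filtration `𝓕` such
  that `ν`-a.e. curve class is described by the Loewner evolution through a chordal uniformizing
  map `φ` of `(D; a, b)` with driving function `W c`, `W c 0 = 0` (CDHKS Thm. 3 = Kemppainen–
  Smirnov 2017, Thm. 1.5: "a.s., the curve … can be fully described by the Loewner evolution"),
  and `t ↦ W_t`, `t ↦ W_t² - 3t` are `𝓕`-martingales under `ν`, then `ν` IS the chordal SLE₃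
  law of `(D; a, b)` (`IsSLELaw 3 D ν`). Proof: `W/√3` is a continuous local martingale with
  `⟨W/√3⟩_t = t` (`isLocalMartingale_and_hasQuadraticVariation_of_martingales`,
  `InterfaceSLEIdentification.lean`) and the tree's unconditional martingale identification
  criterion for `κ < 4` applies (`isSLELaw_of_isLocalMartingale_driving_of_lt_four`,
  `RandomPlanarGeometry/SLELawOfDrivingProcessLocal.lean`: Lévy's characterisation
  `Process.levy_characterisation_holds`; the existence of the SLE_κ trace from the existence of
  *any* Brownian motion whose `√κ`-multiple almost surely drives a generated Loewner chain —
  Lusin–Souslin measurability of that event and uniqueness of the Brownian path law, the limit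
  argument of Lawler–Schramm–Werner 2004, Thm. 4.7, and Kemppainen–Smirnov 2017, Cor. 1.7 — and
  transience of the SLE_κ trace for `κ < 4`, `SLETransienceLocal.lean`). **The two Rohde–Schramm
  inputs of `InterfaceSLEIdentification.lean` thus drop out.**
* `isSLELaw_three_of_subseqLimit_spinInterface_of_forall_drivingMartingales` (**global form**):
  if every subsequential weak limit of the critical spin-Ising interface laws carries such data
  (CDHKS Thm. 3 and §3 up to its last sentence), the identification fact **F2**
  `isSLELaw_three_of_subseqLimit_spinInterface` holds; and with the traversal bound (C1)
  `spinInterface_traversalBound` so does the corrected statement S17-zd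
  (`convergesInLawToSLE_three_isingInterface_zd_of_traversalBound_of_forall_drivingMartingales`).

**Review note (D-0026, 2026-08-15): the named fact (M) is merged back into F2.** Earlier versions
of this file took the hypothesis of the global form as a named fact, (M)
`exists_drivingMartingales_of_subseqLimit_spinInterface` (`InterfaceSLEIdentification.lean`), and
showed that F2 rests on (M) alone. The review of that decomposition found (M) to be a slice of
F2's own printed proof — F2 minus the sentence proved here, with exactly the same unvendored
inputs: Kemppainen–Smirnov 2017, Thm. 1.5 with Cor. 1.7 (Loewner describability of the limit,
convergence of the driving processes, exponential moments) and Chelkak–Smirnov 2012, Thms 1.2,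
5.6 (convergence of the fermionic observable, a martingale of the exploration) — and, being
stated with TRUE martingales, even to require the moment clause of CDHKS Thm. 3 that F2 does not
need (`InterfaceSLELocal.lean`, `InterfaceSLELimitData.lean`: F2 follows moment-free from
describability, driver convergence and the discrete observable martingales, by localisation).
(M) is therefore merged back into F2's proof obligation: the def is deleted and its content
survives as the explicit hypotheses of the two theorems below. After this file the named-fact
frontier below `convergesInLawToSLE_three_isingInterface_zd` is `spinInterface_traversalBound`
(C1, CDHKS §2) and `isSLELaw_three_of_subseqLimit_spinInterface` (F2, CDHKS §3; a theory:
Kemppainen–Smirnov 2017 and Chelkak–Smirnov 2012), the latter reduced further — by theorems only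
— in `InterfaceSLECylinder.lean`, `InterfaceSLELocal.lean` and `InterfaceSLELimitData.lean`.
Nothing is redefined; no named fact is introduced.

## References

* D. Chelkak, H. Duminil-Copin, C. Hongler, A. Kemppainen, S. Smirnov, *Convergence of Ising
  interfaces to Schramm's SLE curves*, C. R. Math. Acad. Sci. Paris 352 (2014) 157–161
  (arXiv:1312.0533): Thm. 1, Thm. 3 (arXiv p. 5: "a.s., the curve `γ_𝔻` can be fully described
  by the Loewner evolution … with a driving process `W_t`"), §3 (arXiv p. 7, proof of Thm. 1,
  last paragraph: "both coefficients `W_t` and `W_t² - 3t` are martingales. As `W_t` is almost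
  surely continuous, Lévy's theorem implies that `W_t = √3 B_t` … for any subsequential limit of
  the curves `γ^δ`").
* A. Kemppainen, S. Smirnov, *Random curves, scaling limits and Loewner evolutions*, Ann. Probab.
  45 (2017) 698–779, Thm. 1.5 and Cor. 1.7 (arXiv:1212.6215v3: Thm. 1.3, Cor. 1.5).
* D. Chelkak, S. Smirnov, *Universality in the 2D Ising model and conformal invariance of
  fermionic observables*, Invent. Math. 189 (2012) 515–580, Thms 1.2 and 5.6.
* G. F. Lawler, O. Schramm, W. Werner, Ann. Probab. 32 (2004), proof of Thm. 4.7.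
* S. Rohde, O. Schramm, *Basic properties of SLE*, Ann. of Math. 161 (2005), Thms 5.1, 7.1.
* D. Revuz, M. Yor, *Continuous Martingales and Brownian Motion* (1999), Ch. IV, Thm. (3.6).
-/

noncomputable section

open MeasureTheory Filter Topology
open UpperHalfPlane (upperHalfPlaneSet)
open scoped NNReal BoundedContinuousFunction
open Literature.Probability.LatticeModels Literature.Probability.Percolation
open Literature.Probability.RandomPlanarGeometry (CurveClass DobrushinDomain ConformalEquiv)

namespace Literature.Probability.LatticeModels

/-! ### Local form: two driving martingales identify the SLE₃ law -/

/-- **The last paragraph of CDHKS §3, for one limit law.** Let `φ` be a chordal uniformizing map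
of the Dobrushin domain `(D; a, b)`, `ν` a probability measure on curve classes,
`W : CurveClass ℂ → ([0, ∞) → ℝ)` a process on the curve space and `𝓕` a filtration of sub-σ-
algebras of the Borel σ-algebra such that: `ν`-a.e. curve class `c` is described by the Loewner
evolution through `φ` with driving function `W c` (`IsLoewnerDescribed φ c (W c)`: the Loewner
chain of `W c` is generated by a curve in `ℍ̄`, parametrised by half-plane capacity, whose
time-compactified `φ`-image ending at `b` is `c`) and `W c 0 = 0` — CDHKS Thm. 3 (= Kemppainen–
Smirnov 2017, Thm. 1.5): "a.s., the curve … can be fully described by the Loewner evolution …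
with a driving process `W_t`", `γ_ℍ` starting at `0` —, and **`t ↦ W_t` and `t ↦ W_t² - 3t` are
`𝓕`-martingales under `ν`** (CDHKS §3: "both coefficients `W_t` and `W_t² - 3t` are
martingales"). Then `ν` is the chordal SLE₃ law of `(D; a, b)`: "As `W_t` is almost surely
continuous, Lévy's theorem implies that `W_t = √3 B_t`" — `W/√3` is a continuous local
martingale started at `0` with `⟨W/√3⟩_t = t`
(`isLocalMartingale_and_hasQuadraticVariation_of_martingales`), and the tree's unconditional
criterion `isSLELaw_of_isLocalMartingale_driving_of_lt_four` (`κ = 3 < 4`: Lévy's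
characterisation, the SLE₃ trace from the Brownian driving process, transience of the SLE₃
trace — all theorems) identifies `ν`. PROVED. [cite: CDHKSCRAS2014, §3 (proof of Thm. 1)] -/
theorem isSLELaw_three_of_drivingMartingales {D : DobrushinDomain}
    {φ : ConformalEquiv upperHalfPlaneSet D.carrier} (hφ : D.IsChordalUniformizing φ)
    {ν : Measure (CurveClass ℂ)} [IsProbabilityMeasure ν] {W : CurveClass ℂ → ℝ≥0 → ℝ}
    {𝓕 : Filtration ℝ≥0 (inferInstance : MeasurableSpace (CurveClass ℂ))}
    (hae : ∀ᵐ c ∂ν, RandomPlanarGeometry.IsLoewnerDescribed φ c (W c) ∧ W c 0 = 0)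
    (hM₁ : Martingale (fun t c => W c t) 𝓕 ν)
    (hM₂ : Martingale (fun t c => W c t ^ 2 - 3 * (t : ℝ)) 𝓕 ν) :
    RandomPlanarGeometry.IsSLELaw 3 D ν := by
  obtain ⟨hloc, hQ⟩ := isLocalMartingale_and_hasQuadraticVariation_of_martingales hM₁ hM₂
  have hsq : Real.sqrt ((3 : ℝ≥0) : ℝ) = Real.sqrt 3 := by norm_num
  refine RandomPlanarGeometry.isSLELaw_of_isLocalMartingale_driving_of_lt_four zero_lt_three
    (by norm_num) hφ (measurable_of_martingale hM₁) ?_ ?_ hloc ?_ ?_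
  · filter_upwards [hae] with c hc using hc.2
  · filter_upwards [hae] with c hc using hc.1.continuous
  · simpa only [hsq] using hQ
  · filter_upwards [hae] with c hc
    obtain ⟨-, γ, hγ, c', hc', hI⟩ := hc.1
    exact ⟨γ, hγ, c', hc', hI⟩

/-! ### Global form: F2 and the corrected statement -/

/-- **F2 from the two driving martingales of every subsequential limit.** Suppose that for every
Dobrushin domain `(D; a, b)`, admissible `δℤ²` discretisations `E` (`IsDiscretisation D E`),
interface-selection rules `sel`, meshes `u n → 0⁺` and every probability measure `ν` on
`CurveClass ℂ` to which the laws `spinInterfaceLaw D E sel (u n)` of the critical spin-Ising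
Dobrushin interfaces converge weakly (bounded continuous test functions), there are a chordal
uniformizing map `φ : ℍ → D` (`0 ↦ a`, `∞ ↦ b`), a process `W : CurveClass ℂ → ([0, ∞) → ℝ)`
and a filtration `𝓕` with: `ν`-a.e. `IsLoewnerDescribed φ c (W c)` and `W c 0 = 0` (CDHKS
Thm. 3 = Kemppainen–Smirnov 2017, Thm. 1.5 with Cor. 1.7, from Condition G verified in CDHKS §2
by Thm. 4 and Rem. 4), and `W_t`, `W_t² - 3t` martingales for `𝓕` under `ν` (CDHKS §3: the
fermionic observable of Chelkak–Smirnov 2012, Thms 1.2, 5.6, passes to the limit and is expanded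
at `∞`). Then every such `ν` is the chordal SLE₃ law of `(D; a, b)`: the named fact F2
`isSLELaw_three_of_subseqLimit_spinInterface` (`InterfaceSLEProofs.lean`) holds, by
`isSLELaw_three_of_drivingMartingales`. The hypothesis is the statement formerly vendored as the
named fact (M) `exists_drivingMartingales_of_subseqLimit_spinInterface`, merged back into F2
(module docstring); as for F2, the printed argument concerns the interface explored with the
domain Markov property (leftmost/rightmost or locally decided), general selection rules resting
on CDHKS's "we obtain the same limit for all choices of `γ^δ`" (§1). PROVED.
[cite: CDHKSCRAS2014, Thm. 3 and §3 (proof of Thm. 1)] -/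
theorem isSLELaw_three_of_subseqLimit_spinInterface_of_forall_drivingMartingales
    (h : ∀ (D : DobrushinDomain) (E : ℝ → DiscreteDobrushin) (_hE : IsDiscretisation D E)
      (sel : ℝ → SpinConfig (Site 2) → List (Sym2 (Site 2)))
      (_hsel : ∀ δ, IsInterfaceSelection (E δ) (sel δ))
      (u : ℕ → ℝ) (_hu : Tendsto u atTop (𝓝[>] 0))
      (ν : Measure (CurveClass ℂ)) [IsProbabilityMeasure ν],
      (∀ f : CurveClass ℂ →ᵇ ℝ,
        Tendsto (fun n => ∫ c, f c ∂spinInterfaceLaw D E sel (u n)) atTop (𝓝 (∫ c, f c ∂ν))) →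
      ∃ (φ : ConformalEquiv upperHalfPlaneSet D.carrier) (W : CurveClass ℂ → ℝ≥0 → ℝ)
        (𝓕 : Filtration ℝ≥0 (inferInstance : MeasurableSpace (CurveClass ℂ))),
        D.IsChordalUniformizing φ ∧
        (∀ᵐ c ∂ν, RandomPlanarGeometry.IsLoewnerDescribed φ c (W c) ∧ W c 0 = 0) ∧
        Martingale (fun t c => W c t) 𝓕 ν ∧
        Martingale (fun t c => W c t ^ 2 - 3 * (t : ℝ)) 𝓕 ν) :
    isSLELaw_three_of_subseqLimit_spinInterface := by
  intro D E hE sel hsel u hu ν hν hlim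
  obtain ⟨φ, W, 𝓕, hφ, hae, hM₁, hM₂⟩ := h D E hE sel hsel u hu ν hlim
  exact isSLELaw_three_of_drivingMartingales hφ hae hM₁ hM₂

/-- **CDHKS Theorem 1 (corrected transcription) from (C1) and the two driving martingales.**
Convergence in law of the critical spin-Ising Dobrushin interfaces to chordal SLE₃,
`convergesInLawToSLE_three_isingInterface_zd`, follows from the traversal bound (C1)
`spinInterface_traversalBound` (CDHKS §2: Thm. 3 = Kemppainen–Smirnov 2017, Thm. 4 =
Chelkak–Duminil-Copin–Hongler 2016, Rem. 4) and the driving-martingale data of every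
subsequential limit (hypothesis of
`isSLELaw_three_of_subseqLimit_spinInterface_of_forall_drivingMartingales`; CDHKS Thm. 3 and §3).
Tightness from (C1), Prokhorov and the subsequence principle, uniqueness in law of chordal SLE,
Lévy's characterisation and the Rohde–Schramm trace theorems at `κ = 3` are theorems of the tree
(`convergesInLawToSLE_three_isingInterface_zd_of_traversalBound'`). PROVED.
[cite: CDHKSCRAS2014, Thm. 1, §§2–3] -/
theorem convergesInLawToSLE_three_isingInterface_zd_of_traversalBound_of_forall_drivingMartingales
    (h1 : spinInterface_traversalBound)
    (h : ∀ (D : DobrushinDomain) (E : ℝ → DiscreteDobrushin) (_hE : IsDiscretisation D E)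
      (sel : ℝ → SpinConfig (Site 2) → List (Sym2 (Site 2)))
      (_hsel : ∀ δ, IsInterfaceSelection (E δ) (sel δ))
      (u : ℕ → ℝ) (_hu : Tendsto u atTop (𝓝[>] 0))
      (ν : Measure (CurveClass ℂ)) [IsProbabilityMeasure ν],
      (∀ f : CurveClass ℂ →ᵇ ℝ,
        Tendsto (fun n => ∫ c, f c ∂spinInterfaceLaw D E sel (u n)) atTop (𝓝 (∫ c, f c ∂ν))) →
      ∃ (φ : ConformalEquiv upperHalfPlaneSet D.carrier) (W : CurveClass ℂ → ℝ≥0 → ℝ)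
        (𝓕 : Filtration ℝ≥0 (inferInstance : MeasurableSpace (CurveClass ℂ))),
        D.IsChordalUniformizing φ ∧
        (∀ᵐ c ∂ν, RandomPlanarGeometry.IsLoewnerDescribed φ c (W c) ∧ W c 0 = 0) ∧
        Martingale (fun t c => W c t) 𝓕 ν ∧
        Martingale (fun t c => W c t ^ 2 - 3 * (t : ℝ)) 𝓕 ν) :
    convergesInLawToSLE_three_isingInterface_zd :=
  convergesInLawToSLE_three_isingInterface_zd_of_traversalBound' h1
    (isSLELaw_three_of_subseqLimit_spinInterface_of_forall_drivingMartingales h)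

end Literature.Probability.LatticeModels
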